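import Literature.Combinatorics.Sahi2008.Multilinear
import Literature.Combinatorics.Sahi2008.Symmetry
import HarnessLib

/-!
# `NoHeavyLowerTail` (crux stmt-CriticalPhenomena-4575), Sahi programme: **`E_n` is ANTITONE in the proper mixed moments of one slot**
# (the erasure step of the all-orders contraction theorem for cylinder pairs, proved through the Lieb–Sahi recursion)

Support file (Sahi cell, seat `prim-sahi-p1`, generation 50; `--supports stmt-CriticalPhenomena-4575`).  Pure proofs, NO definitions, no `sorry`,
standard axioms.  Vocabulary: `sahiE`, `ex` of `Literature/Combinatorics/Sahi2008`.

THE RESULT (`sahiE_update_le_of_moments`).  Let `μ` be ANY real weight on a finite type, `f` an `n`-family of real functions, `k` a slot and `u, v` two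
candidate functions for slot `k` such that
* the mixed moments through slot `k` increase: `E(u·Π_{i∈S} f_i) ≤ E(v·Π_{i∈S} f_i)` for every `S ∌ k`,
* with EQUALITY on the full product `S = [n] ∖ {k}`, and
* every subfamily of `f` avoiding slot `k` has `E_m ≥ 0`.
Then `E_n(f[k := v]) ≤ E_n(f[k := u])`.
MOMENT READING: `E_n` is affine in the group of moments `{M_B : B ∋ k}` with coefficient `−(|B|−1)!·E_{n−|B|}(f|_{Bᶜ})` on `M_B` for `B ≠ [n]` and
`+(n−1)!` on `M_{[n]}` (each set partition has exactly one block through `k`); the hypotheses make every variable term decrease.  Here this is proved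
WITHOUT the set-partition form, by induction through the recursion `E_{n+2}(f_0; g) = Σ_i E_{n+1}(g[i := g_i f_0]) − E_{n+1}(g)·E(f_0)` (the tree's
definition of `sahiE`) with the distinguished slot moved to position `0` (`sahiE_comp_perm`): the merged slot `g_i f_0` satisfies the same hypotheses
one order down, and the last term moves the right way because `E_{n+1}(g) ≥ 0` and `E(u) ≤ E(v)`.
USE (file `…SahiTangentCylinderPairsAllOrders`): erasing from the bottom cylinder of a pair slot a coordinate that lies in another bottom raises the
proper bottom moments and fixes the full one, so it can only DECREASE `E_n^{B_s⊗μ}` — the reduction of the all-orders contraction inequality for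
cylinder pairs to frozen configurations (memo FROM-prim-sahi-p1-gen49-PRINCIPAL-BOTTOM-TANGENT §A2, done there by explicit polynomials at orders 3, 4).
Nothing conjectural is asserted. [this work]
-/

namespace Summit.CriticalPhenomena.PercolationContinuityZ3.Theorems.SahiTangent

open Finset Function Literature.Combinatorics.Sahi2008
open scoped BigOperators

variable {α : Type*} [Fintype α]

/-! ### Plumbing: products of the tail family, the successor embedding -/

omit [Fintype α] in
/-- Products of the tail family are products of the family over the shifted index set. [folklore] -/
theorem prod_tail_eq_prod_map_succ {n : ℕ} (f : Fin (n + 2) → α → ℝ) (S : Finset (Fin (n + 1))) :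
    ∏ j ∈ S, Fin.tail f j = ∏ j ∈ S.map (Fin.succEmb (n + 1)), f j := by
  rw [Finset.prod_map]
  rfl

/-- `0` is not a successor. [folklore] -/
theorem zero_notMem_map_succEmb {n : ℕ} (S : Finset (Fin (n + 1))) : (0 : Fin (n + 2)) ∉ S.map (Fin.succEmb (n + 1)) := by
  intro h
  obtain ⟨j, _, hj⟩ := Finset.mem_map.1 h
  exact Fin.succ_ne_zero j hj

/-- The successors are everything but `0`. [folklore] -/
theorem map_succEmb_univ {n : ℕ} : (univ : Finset (Fin (n + 1))).map (Fin.succEmb (n + 1)) = univ.erase 0 := by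
  ext j
  simp only [Finset.mem_map, Finset.mem_univ, true_and, Finset.mem_erase, and_true]
  constructor
  · rintro ⟨i, rfl⟩
    exact Fin.succ_ne_zero i
  · intro hj
    obtain ⟨i, rfl⟩ := Fin.exists_succ_eq.2 hj
    exact ⟨i, rfl⟩

/-! ### The monotonicity lemma -/

/-- **Slot `0` step.**  Given the statement one order down (for every slot), the antitonicity of `E_{n+2}` in the proper mixed moments of slot `0`
follows from the Lieb–Sahi recursion. [this work] -/
theorem sahiE_update_le_of_moments_zero (μ : α → ℝ) {n : ℕ}
    (ih : ∀ (f : Fin (n + 1) → α → ℝ) (k : Fin (n + 1)) (u v : α → ℝ),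
      (∀ S : Finset (Fin (n + 1)), k ∉ S → ex μ (u * ∏ i ∈ S, f i) ≤ ex μ (v * ∏ i ∈ S, f i)) →
      ex μ (u * ∏ i ∈ univ.erase k, f i) = ex μ (v * ∏ i ∈ univ.erase k, f i) →
      (∀ (m : ℕ) (e : Fin m → Fin (n + 1)), Injective e → (∀ j, e j ≠ k) → 0 ≤ sahiE μ m (fun j => f (e j))) →
      sahiE μ (n + 1) (update f k v) ≤ sahiE μ (n + 1) (update f k u))
    (f : Fin (n + 2) → α → ℝ) (u v : α → ℝ)
    (hle : ∀ S : Finset (Fin (n + 2)), 0 ∉ S → ex μ (u * ∏ i ∈ S, f i) ≤ ex μ (v * ∏ i ∈ S, f i))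
    (heq : ex μ (u * ∏ i ∈ univ.erase 0, f i) = ex μ (v * ∏ i ∈ univ.erase 0, f i))
    (hpos : ∀ (m : ℕ) (e : Fin m → Fin (n + 2)), Injective e → (∀ j, e j ≠ 0) → 0 ≤ sahiE μ m (fun j => f (e j))) :
    sahiE μ (n + 2) (update f 0 v) ≤ sahiE μ (n + 2) (update f 0 u) := by
  rw [sahiE_succ_succ, sahiE_succ_succ, Fin.tail_update_zero, Fin.tail_update_zero, update_self, update_self]
  have htail : 0 ≤ sahiE μ (n + 1) (Fin.tail f) :=
    hpos (n + 1) Fin.succ (Fin.succ_injective _) (fun j => Fin.succ_ne_zero j)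
  have hex : ex μ u ≤ ex μ v := by
    have h := hle ∅ (Finset.notMem_empty _)
    simpa only [Finset.prod_empty, mul_one] using h
  have hsum : ∀ i : Fin (n + 1),
      sahiE μ (n + 1) (update (Fin.tail f) i (Fin.tail f i * v)) ≤ sahiE μ (n + 1) (update (Fin.tail f) i (Fin.tail f i * u)) := by
    intro i
    have e1 : ∀ (w : α → ℝ) (S : Finset (Fin (n + 1))), i ∉ S →
        Fin.tail f i * w * ∏ j ∈ S, Fin.tail f j = w * ∏ j ∈ (insert i S).map (Fin.succEmb (n + 1)), f j := by
      intro w S hS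
      rw [← prod_tail_eq_prod_map_succ, Finset.prod_insert hS]
      ring
    refine ih (Fin.tail f) i (Fin.tail f i * u) (Fin.tail f i * v) ?_ ?_ ?_
    · intro S hS
      rw [e1 u S hS, e1 v S hS]
      exact hle _ (zero_notMem_map_succEmb _)
    · rw [e1 u _ (Finset.notMem_erase i univ), e1 v _ (Finset.notMem_erase i univ), Finset.insert_erase (Finset.mem_univ i),
        map_succEmb_univ]
      exact heq
    · intro m e he he0
      exact hpos m (fun j => (e j).succ) (fun a b h => he (Fin.succ_injective _ h)) (fun j => Fin.succ_ne_zero _)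
  have hs := Finset.sum_le_sum fun i (_ : i ∈ (univ : Finset (Fin (n + 1)))) => hsum i
  nlinarith [mul_le_mul_of_nonneg_left hex htail]

/-- **`E_n` is antitone in the proper mixed moments of one slot.**  For any real weight `μ` on a finite type, an `n`-family `f`, a slot `k` and functions
`u, v` with `E(u·Π_{i∈S} f_i) ≤ E(v·Π_{i∈S} f_i)` for all `S ∌ k`, equality for `S = [n] ∖ {k}`, and `E_m ≥ 0` for every subfamily of `f` avoiding
slot `k`:  `E_n(f[k := v]) ≤ E_n(f[k := u])`.  (Moment form: the coefficient of `M_B`, `B ∋ k`, `B ≠ [n]`, in `E_n` is `−(|B|−1)!·E_{n−|B|}(f|_{Bᶜ}) ≤ 0`.)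
[this work] -/
theorem sahiE_update_le_of_moments (μ : α → ℝ) :
    ∀ (n : ℕ) (f : Fin n → α → ℝ) (k : Fin n) (u v : α → ℝ),
      (∀ S : Finset (Fin n), k ∉ S → ex μ (u * ∏ i ∈ S, f i) ≤ ex μ (v * ∏ i ∈ S, f i)) →
      ex μ (u * ∏ i ∈ univ.erase k, f i) = ex μ (v * ∏ i ∈ univ.erase k, f i) →
      (∀ (m : ℕ) (e : Fin m → Fin n), Injective e → (∀ j, e j ≠ k) → 0 ≤ sahiE μ m (fun j => f (e j))) →
      sahiE μ n (update f k v) ≤ sahiE μ n (update f k u) := by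
  intro n
  induction n with
  | zero => intro f k; exact k.elim0
  | succ n ih =>
    cases n with
    | zero =>
      intro f k u v _ heq _
      have hk : k = 0 := Fin.ext (by have := k.isLt; omega)
      subst hk
      rw [sahiE_one_apply, sahiE_one_apply, update_self, update_self]
      have h0 : (univ : Finset (Fin (0 + 1))).erase 0 = ∅ :=
        Finset.eq_empty_of_forall_notMem fun i hi =>
          (Finset.mem_erase.1 hi).1 (Fin.ext (by have := i.isLt; omega))
      rw [h0, Finset.prod_empty, mul_one, mul_one] at heq
      exact le_of_eq heq.symm
    | succ n =>
      intro f k u v hle heq hpos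
      -- move slot `k` to position `0`
      set σ : Equiv.Perm (Fin (n + 2)) := Equiv.swap 0 k with hσ
      have hσk : σ.symm k = 0 := by rw [hσ, Equiv.symm_swap, Equiv.swap_apply_right]
      have hσ0 : σ 0 = k := by rw [hσ, Equiv.swap_apply_left]
      have tr : ∀ w : α → ℝ, sahiE μ (n + 2) (update f k w) = sahiE μ (n + 2) (update (fun i => f (σ i)) 0 w) := by
        intro w
        rw [← sahiE_comp_perm μ (n + 2) σ (update f k w)]
        congr 1
        funext i
        rw [Function.update_apply_equiv_apply f σ k w i, hσk]
        rfl
      rw [tr, tr]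
      refine sahiE_update_le_of_moments_zero μ ih (fun i => f (σ i)) u v ?_ ?_ ?_
      · intro S hS
        have e : ∀ w : α → ℝ, w * ∏ i ∈ S, f (σ i) = w * ∏ i ∈ S.map σ.toEmbedding, f i := by
          intro w; rw [Finset.prod_map]; rfl
        rw [e, e]
        refine hle _ fun hk => ?_
        obtain ⟨j, hj, hjk⟩ := Finset.mem_map.1 hk
        have hj0 : j = 0 := by
          rw [← hσk, Equiv.eq_symm_apply]
          exact hjk
        exact hS (hj0 ▸ hj)
      · have e : ∀ w : α → ℝ, w * ∏ i ∈ univ.erase (0 : Fin (n + 2)), f (σ i) = w * ∏ i ∈ univ.erase k, f i := by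
          intro w
          calc w * ∏ i ∈ univ.erase (0 : Fin (n + 2)), f (σ i) = w * ∏ i ∈ (univ.erase (0 : Fin (n + 2))).map σ.toEmbedding, f i := by
                rw [Finset.prod_map]; rfl
            _ = w * ∏ i ∈ univ.erase k, f i := by rw [Finset.map_erase, Finset.map_univ_equiv, Equiv.coe_toEmbedding, hσ0]
        rw [e, e]
        exact heq
      · intro m e he he0
        refine hpos m (fun j => σ (e j)) (σ.injective.comp he) fun j h => he0 j ?_
        rw [← hσk, Equiv.eq_symm_apply]
        exact h

end Summit.CriticalPhenomena.PercolationContinuityZ3.Theorems.SahiTangent
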